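import Summits.ResolutionOfSingularities.ResolutionOfSingularities.Theorems.PurelyInseparableDim4IsolationConverse
import Mathlib.FieldTheory.IsAlgClosed.AlgebraicClosure
import HarnessLib
import HarnessLib.Audit.Tags

/-!
# Purely inseparable fourfolds — F4-I may be checked over PERFECT (indeed algebraically closed) fields only
# [OURS · counted 0 · a reduction inside OUR frame, not about resolution]

Census cell «res-dim4-pi» (D-0157 DOOR 2), width seat `res-dim4-p-14`, brick PR-12m = item **(D-e)** of
the F4-I BRIDGE (desk WORD #30 (b); bridge lead p-12, `…WildConesBridge.lean`): the tree theorem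
`WildCones.IsolatedForcedTermination` (stmt-16343, no infinite isolated `p`-fold point-blow-up run)
is stated over PERFECT fields, whereas F4-I `NoIsolatedTrap p q` quantifies over every field of
characteristic `p`.  Base change closes the gap: by PR-12f (`IsolationConverse.step0_map`,
`isIsolated_map`) an infinite isolated `Step0` chain over `K` maps, state by state
`(F, r, exc) ↦ (F ⊗ L, r, exc)`, to one over any extension `L` — in particular over the algebraic
closure, which is perfect.

* `isolatedChain_map` — chains go up along any `f : K →+* L`;
* **`noIsolatedTrap_of_forall_isAlgClosed`**, **`noIsolatedTrap_of_forall_perfectField`** — to prove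
  `NoIsolatedTrap p q` it suffices to exclude infinite isolated `Step0` chains over algebraically closed
  (resp. perfect) fields of characteristic `p` (`AlgebraicClosure K`, Mathlib's `CharP` instance for it,
  `IsAlgClosed.perfectField`, `Classical.decEq`);
* `noIsolatedTrap_iff_forall_perfectField` — the equivalence (the other direction is specialisation).

Nothing here proves `NoIsolatedTrap` or resolution of singularities in dimension ≥ 4 / characteristic
`p`; counted 0; AI work, weaker than expert review.
bears_on: LADDER-RESOLUTION:D157-DOOR2 (res-dim4-pi · PR-12m · F4-I bridge (D-e)). Supports
stmt-ResolutionOfSingularities-16155 (helper).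
-/

set_option linter.dupNamespace false

noncomputable section

namespace Summit.ResolutionOfSingularities.ResolutionOfSingularities.Theorems.PIDim4

namespace IsolatedChainBaseChange

open Literature.AlgebraicGeometry.Resolution

/-- **Isolated `Step0` chains go up** along any homomorphism of fields. [folklore] -/
theorem isolatedChain_map {K L : Type} [Field K] [Field L] [DecidableEq K] [DecidableEq L]
    (f : K →+* L) {q : ℕ} {c : ℕ → State K}
    (hc : ∀ k, IsIsolated q (c k).F ∧ Step0 q (c k) (c (k + 1))) :
    ∀ k, IsIsolated q ((⟨MvPolynomial.map f (c k).F, (c k).r, (c k).exc⟩ : State L)).F ∧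
      Step0 q (⟨MvPolynomial.map f (c k).F, (c k).r, (c k).exc⟩ : State L)
        ⟨MvPolynomial.map f (c (k + 1)).F, (c (k + 1)).r, (c (k + 1)).exc⟩ :=
  fun k => ⟨IsolationConverse.isIsolated_map f (hc k).1, IsolationConverse.step0_map f (hc k).2⟩

/-- An infinite isolated `Step0` chain over `K` yields one over any extension `L`. [folklore] -/
theorem exists_isolatedChain_map {K L : Type} [Field K] [Field L] [DecidableEq K] [DecidableEq L]
    (f : K →+* L) {q : ℕ}
    (h : ∃ c : ℕ → State K, ∀ k, IsIsolated q (c k).F ∧ Step0 q (c k) (c (k + 1))) :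
    ∃ c : ℕ → State L, ∀ k, IsIsolated q (c k).F ∧ Step0 q (c k) (c (k + 1)) := by
  obtain ⟨c, hc⟩ := h
  exact ⟨fun k => ⟨MvPolynomial.map f (c k).F, (c k).r, (c k).exc⟩, isolatedChain_map f hc⟩

/-- **F4-I may be checked over ALGEBRAICALLY CLOSED fields**: if no algebraically closed field of
characteristic `p` carries an infinite isolated `Step0` chain, then `NoIsolatedTrap p q`.
[folklore] -/
theorem noIsolatedTrap_of_forall_isAlgClosed (p q : ℕ)
    (h : ∀ (L : Type) [Field L] [IsAlgClosed L] [CharP L p] [DecidableEq L],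
      ¬ ∃ c : ℕ → State L, ∀ k, IsIsolated q (c k).F ∧ Step0 q (c k) (c (k + 1))) :
    NoIsolatedTrap p q := by
  intro K _ _ _ hK
  letI : DecidableEq (AlgebraicClosure K) := Classical.decEq _
  exact h (AlgebraicClosure K) (exists_isolatedChain_map (algebraMap K (AlgebraicClosure K)) hK)

/-- **F4-I may be checked over PERFECT fields** (the hypothesis shape of the tree's
`WildCones.IsolatedForcedTermination`): if no perfect field of characteristic `p` carries an infinite
isolated `Step0` chain, then `NoIsolatedTrap p q`. [folklore] -/
theorem noIsolatedTrap_of_forall_perfectField (p q : ℕ)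
    (h : ∀ (L : Type) [Field L] [CharP L p] [PerfectField L] [DecidableEq L],
      ¬ ∃ c : ℕ → State L, ∀ k, IsIsolated q (c k).F ∧ Step0 q (c k) (c (k + 1))) :
    NoIsolatedTrap p q :=
  noIsolatedTrap_of_forall_isAlgClosed p q fun L _ _ _ _ => h L

/-- The equivalence: `NoIsolatedTrap p q` iff no PERFECT field of characteristic `p` carries an infinite
isolated `Step0` chain. [folklore] -/
theorem noIsolatedTrap_iff_forall_perfectField (p q : ℕ) :
    NoIsolatedTrap p q ↔
      ∀ (L : Type) [Field L] [CharP L p] [PerfectField L] [DecidableEq L],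
        ¬ ∃ c : ℕ → State L, ∀ k, IsIsolated q (c k).F ∧ Step0 q (c k) (c (k + 1)) :=
  ⟨fun h L _ _ _ _ => h L, noIsolatedTrap_of_forall_perfectField p q⟩

end IsolatedChainBaseChange

end Summit.ResolutionOfSingularities.ResolutionOfSingularities.Theorems.PIDim4

end
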